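import Summits.AtomisticToContinuum.HydrodynamicLimit.Theses.JParityClosure

/-!
# `RateFloor` (stmt-AtomisticToContinuum-13080) — the restatement this seat's `verdict: misstated` names

Line lead c10 (prover-line-stmt-AtomisticToContinuum-13080-c10-0, 2026-08-17).  Evidence file, NOT a proposal
(it declares a `def`; the text belongs in the route file via a planner `route edit --restate`).

* `RateFloorAnchored` — byte-identical to the strategist's `Cruxes/RateFloor/StrategistAnchoredSkeleton.lean`
  (`…AnchoredWindowTransport.RateFloorAnchored`): the filed text moved into the route's guarded frame
  (`IsHardSphereEulerSolution σ T ρ u θ`, flows with the `t = 0` LLN, horizon `0 < τ < T`) and made conditional on the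
  field LLN on `[0, τ]`; everything from `∀ χ` on is the filed text verbatim.
* `rateFloorAnchored_of_rateFloor` — it is a WEAKENING of the filed crux (so rung 0 p123815 and the 46 landed
  `--supports` files keep their value).
* `ParityBandClosureAnchored` / `closes_anchored` — the glue stays one line: restating crux 7's third hypothesis
  alongside keeps the deciding theorem `closes` valid verbatim in shape (`h₇ h₂ h₃ h₄ h₅ h₆`).
* `parityBandClosure_of_anchored` — the restated closure crux IMPLIES the filed one (it is the stronger
  implication), so nothing already filed against `ParityBandClosure` is lost either.
* Variant R2 (recommended primary form, VERDICT-c10.md §2b): `RateFloorEntropicAnchor` (strategist l. 66–67,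
  hypothesis = the uniform entropic anchor on `[0,τ]`), with `rateFloorEntropicAnchor_of_rateFloor`,
  `ParityBandClosureEntropic`, `parityBandClosure_of_entropic`, `closes_entropic`.
-/

namespace Summit.AtomisticToContinuum.HydrodynamicLimit.Theorems.RateFloorRestated

open Summit.AtomisticToContinuum.HydrodynamicLimit.Theses.JParityClosure

/-- **RateFloorAnchored** — proposed replacement text for `Theses.JParityClosure.RateFloor` (guarded frame +
hydrodynamic anchor on `[0,τ]`; after `∀ χ` verbatim the filed text). [folklore] -/
def RateFloorAnchored : Prop :=
  ∃ g₀ : ℝ, 0 < g₀ ∧ ∀ (a₀ θ₀ : Literature.MathematicalPhysics.KineticTheory.T3 → ℝ) (u₀ : Literature.MathematicalPhysics.KineticTheory.T3 → Literature.MathematicalPhysics.KineticTheory.V3), Continuous a₀ → Continuous θ₀ → Continuous u₀ → (∀ x, 0 < a₀ x) → (∀ x, 0 < θ₀ x) → ∃ σ₀ : ℝ, 0 < σ₀ ∧ ∀ σ : ℝ, 0 < σ → σ < σ₀ → ∀ (T : ℝ) (ρ θ : ℝ → Literature.MathematicalPhysics.KineticTheory.T3 → ℝ) (u : ℝ → Literature.MathematicalPhysics.KineticTheory.T3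 → Literature.MathematicalPhysics.KineticTheory.V3), Literature.MathematicalPhysics.KineticTheory.IsHardSphereEulerSolution σ T ρ u θ → ∀ Φ : (N : ℕ) → Literature.Analysis.FluidPDE.HardSphereFlow (Literature.Analysis.FluidPDE.Torus.geometry (Fin 3)) (Literature.MathematicalPhysics.KineticTheory.hsDiameter σ N) (N + 1), Literature.MathematicalPhysics.KineticTheory.TendstoHydroFieldsAt (fun N => Literature.MathematicalPhysics.KineticTheory.localGibbsLaw σ a₀ u₀ θ₀ N (Φ N)) Φ ρ u θ 0 → ∀ τ : ℝ, 0 < τ → τ < T → (∀ s ∈ Set.Icc 0 τ, Literature.MathematicalPhysics.KineticTheory.TendstoHydroFieldsAt (fun N => Literature.MathematicalPhysics.KineticTheory.localGibbsLaw σ a₀ u₀ θ₀ N (Φ N)) Φ ρ u θ s) → ∀ χ : ℝ × UnitAddTorus (Fin 3) → ℝ, Continuous χ → (∀ p, 0 ≤ χ p) → ∀ Ξ : EuclideanSpace ℝ (Fin 3) × EuclideanSpace ℝ (Fin 3) × EuclideanSpace ℝ (Fin 3) → ℝ, Continuous Ξ → (∀ q, 0 ≤ Ξ q) → (∃ C :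 ℝ, ∀ q, Ξ q ≤ C) → ∀ η δ : ℝ, 0 < η → 0 < δ → ∃ r₀ : ℝ, 0 < r₀ ∧ ∀ r : ℝ, 0 < r → r < r₀ → ∃ N₀ : ℕ, ∀ N : ℕ, N₀ ≤ N → let ε := Literature.MathematicalPhysics.KineticTheory.hsDiameter σ N; let G := Literature.Analysis.FluidPDE.Torus.geometry (Fin 3); let γ := fun z (s : ℝ) => (Φ N).flow s z; let bx : UnitAddTorus (Fin 3) → UnitAddTorus (Fin 3) → ℝ := fun x y => 3 / (Real.pi * r ^ 3) * max (1 - Literature.Analysis.FluidPDE.Torus.euclidDist x y / r) 0; let Θ := fun (Ξ : EuclideanSpace ℝ (Fin 3) × EuclideanSpace ℝ (Fin 3) × EuclideanSpace ℝ (Fin 3) → ℝ) (v w : EuclideanSpace ℝ (Fin 3)) => ∫ ω : Metric.sphere (0 : EuclideanSpace ℝ (Fin 3)) 1, Ξ ((ω : EuclideanSpace ℝ (Fin 3)), v, w) * Literature.MathematicalPhysics.KineticTheory.hardSphereKernel (w, v) ω ∂Literature.MathematicalPhysics.KineticTheory.sphereMeasure; let B := fun Ξ z s (x₀ : UnitAddTorus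 (Fin 3)) => ∫ p, bx p.1.1 x₀ * bx p.2.1 x₀ * Θ Ξ p.1.2 p.2.2 ∂((Literature.Analysis.FluidPDE.empiricalMeasure (γ z s)).prod (Literature.Analysis.FluidPDE.empiricalMeasure (γ z s))); let pv := fun z s (i j : Fin (N + 1)) => Literature.Analysis.FluidPDE.reflectVel (G.sepVec (γ z s i).1 (γ z s j).1) ((γ z s i).2, (γ z s j).2); let Kc := fun (Fn : Literature.Analysis.FluidPDE.Config (N + 1) (Fin 3) Literature.MathematicalPhysics.KineticTheory.T3 → ℝ → Fin (N + 1) → Fin (N + 1) → ℝ) z => ε / (N + 1 : ℝ) * ∑ᶠ (s : ℝ) (_ : s ∈ Literature.Analysis.FluidPDE.collisionTimes G ε (γ z) ∩ Set.Icc 0 τ), ∑ i : Fin (N + 1), ∑ j : Fin (N + 1), (if i ≠ j ∧ ‖G.sepVec (γ z s i).1 (γ z s j).1‖ = ε then Fn z s i j else 0); Literature.MathematicalPhysics.KineticTheory.localGibbsLaw σ a₀ u₀ θ₀ N (Φ N) {z | Kc (fun z s i j => χ (s, (γ z s i).1) * Ξ (ε⁻¹ • G.sepVec (γ z s i).1 (γ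 z s j).1, (pv z s i j).1, (pv z s i j).2)) z < g₀ * σ ^ 3 * (∫ s in Set.Icc (0 : ℝ) τ, ∫ x : UnitAddTorus (Fin 3), χ (s, x) * B Ξ z s x) - η} ≤ ENNReal.ofReal δ

/-- The proposed text is a weakening of the filed crux. [folklore] -/
theorem rateFloorAnchored_of_rateFloor (h : RateFloor) : RateFloorAnchored := by
  obtain ⟨g₀, hg₀, H⟩ := h
  refine ⟨g₀, hg₀, fun a₀ θ₀ u₀ ha hθ hu hap hθp => ?_⟩
  obtain ⟨σ₀, hσ₀, H1⟩ := H a₀ θ₀ u₀ ha hθ hu hap hθp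
  exact ⟨σ₀, hσ₀, fun σ hσ hσ' T ρ θ u _ Φ _ τ hτ _ _ => H1 σ hσ hσ' Φ τ hτ⟩

/-- The closure crux with its third hypothesis restated alongside. [folklore] -/
def ParityBandClosureAnchored : Prop :=
  OddContactSymmetry → EvenStressEnskog → RateFloorAnchored → LocalSecondLaw → DensityCap → _root_.HydrodynamicLimit

/-- The restated closure crux implies the filed one (it asks the closure to run on a weaker floor). [folklore] -/
theorem parityBandClosure_of_anchored (h : ParityBandClosureAnchored) : ParityBandClosure :=
  fun h₂ h₃ h₄ h₅ h₆ => h h₂ h₃ (rateFloorAnchored_of_rateFloor h₄) h₅ h₆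

/-- Shape of the deciding theorem after the restatement: still `h₇ h₂ h₃ h₄ h₅ h₆`. [folklore] -/
theorem closes_anchored (h₂ : OddContactSymmetry) (h₃ : EvenStressEnskog) (h₄ : RateFloorAnchored)
    (h₅ : LocalSecondLaw) (h₆ : DensityCap) (h₇ : ParityBandClosureAnchored) : _root_.HydrodynamicLimit :=
  h₇ h₂ h₃ h₄ h₅ h₆

/-! ### Variant R2 — the ENTROPIC anchor as hypothesis (recommended primary form, see VERDICT-c10.md §2b) -/

/-- **RateFloorEntropicAnchor** — guarded frame, hypothesis = the UNIFORM entropic anchor on `[0,τ]`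
(`klDiv(law_s ‖ localGibbsLaw σ (a s) (u s) (θ s)) ≤ κ(N+1)` for all `s ≤ τ`, eventually in `N`, every `κ > 0`,
for a continuous positive activity family `a`); after `∀ χ` verbatim the filed text.  Byte-identical to the
strategist's l. 66–67.  Under this text crux 4's line is S2 + S3 only (one-time statics + per-window transport);
the LLN → entropy bridge lives in the closure step, where `JaynesSqueezeClosure.klCore_of_meanFieldsConverge`
already supplies its pointwise-in-time core. [folklore] -/
def RateFloorEntropicAnchor : Prop :=
  ∃ g₀ : ℝ, 0 < g₀ ∧ ∀ (a₀ θ₀ : Literature.MathematicalPhysics.KineticTheory.T3 → ℝ) (u₀ : Literature.MathematicalPhysics.KineticTheory.T3 → Literature.MathematicalPhysics.KineticTheory.V3), Continuous a₀ → Continuous θ₀ → Continuous u₀ → (∀ x, 0 < a₀ x) → (∀ x, 0 < θ₀ x) → ∃ σ₀ : ℝ, 0 < σ₀ ∧ ∀ σ : ℝ, 0 < σ → σ < σ₀ → ∀ (T : ℝ) (ρ θ : ℝ → Literature.MathematicalPhysics.KineticTheory.T3 → ℝ) (u : ℝ → Literature.MathematicalPhysics.KineticTheory.T3 → Literature.MathematicalPhysics.KineticTheory.V3),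 Literature.MathematicalPhysics.KineticTheory.IsHardSphereEulerSolution σ T ρ u θ → ∀ Φ : (N : ℕ) → Literature.Analysis.FluidPDE.HardSphereFlow (Literature.Analysis.FluidPDE.Torus.geometry (Fin 3)) (Literature.MathematicalPhysics.KineticTheory.hsDiameter σ N) (N + 1), ∀ τ : ℝ, 0 < τ → τ < T → ∀ a : ℝ → Literature.MathematicalPhysics.KineticTheory.T3 → ℝ, (∀ s, Continuous (a s)) → (∀ s x, 0 < a s x) → (∀ κ : ℝ, 0 < κ → ∃ N₁ : ℕ, ∀ N : ℕ, N₁ ≤ N → ∀ s ∈ Set.Icc 0 τ, InformationTheory.klDiv ((Φ N).lawAt (Literature.MathematicalPhysics.KineticTheory.localGibbsLaw σ a₀ u₀ θ₀ N (Φ N)) s) (Literature.MathematicalPhysics.KineticTheory.localGibbsLaw σ (a s) (u s) (θ s) N (Φ N)) ≤ ENNReal.ofReal (κ * ((N : ℝ) + 1))) → ∀ χ : ℝ × UnitAddTorus (Fin 3) → ℝ, Continuous χ → (∀ p, 0 ≤ χ p) → ∀ Ξ : EuclideanSpace ℝ (Fin 3) × EuclideanSpace ℝ (Fin 3) × EuclideanSpace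 ℝ (Fin 3) → ℝ, Continuous Ξ → (∀ q, 0 ≤ Ξ q) → (∃ C : ℝ, ∀ q, Ξ q ≤ C) → ∀ η δ : ℝ, 0 < η → 0 < δ → ∃ r₀ : ℝ, 0 < r₀ ∧ ∀ r : ℝ, 0 < r → r < r₀ → ∃ N₀ : ℕ, ∀ N : ℕ, N₀ ≤ N → let ε := Literature.MathematicalPhysics.KineticTheory.hsDiameter σ N; let G := Literature.Analysis.FluidPDE.Torus.geometry (Fin 3); let γ := fun z (s : ℝ) => (Φ N).flow s z; let bx : UnitAddTorus (Fin 3) → UnitAddTorus (Fin 3) → ℝ := fun x y => 3 / (Real.pi * r ^ 3) * max (1 - Literature.Analysis.FluidPDE.Torus.euclidDist x y / r) 0; let Θ := fun (Ξ : EuclideanSpace ℝ (Fin 3) × EuclideanSpace ℝ (Fin 3) × EuclideanSpace ℝ (Fin 3) → ℝ) (v w : EuclideanSpace ℝ (Fin 3)) => ∫ ω : Metric.sphere (0 : EuclideanSpace ℝ (Fin 3)) 1, Ξ ((ω : EuclideanSpace ℝ (Fin 3)), v, w) * Literature.MathematicalPhysics.KineticTheory.hardSphereKernel (w, v) ω ∂Literature.MathematicalPhysics.KineticTheory.sphereMeasure;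 let B := fun Ξ z s (x₀ : UnitAddTorus (Fin 3)) => ∫ p, bx p.1.1 x₀ * bx p.2.1 x₀ * Θ Ξ p.1.2 p.2.2 ∂((Literature.Analysis.FluidPDE.empiricalMeasure (γ z s)).prod (Literature.Analysis.FluidPDE.empiricalMeasure (γ z s))); let pv := fun z s (i j : Fin (N + 1)) => Literature.Analysis.FluidPDE.reflectVel (G.sepVec (γ z s i).1 (γ z s j).1) ((γ z s i).2, (γ z s j).2); let Kc := fun (Fn : Literature.Analysis.FluidPDE.Config (N + 1) (Fin 3) Literature.MathematicalPhysics.KineticTheory.T3 → ℝ → Fin (N + 1) → Fin (N + 1) → ℝ) z => ε / (N + 1 : ℝ) * ∑ᶠ (s : ℝ) (_ : s ∈ Literature.Analysis.FluidPDE.collisionTimes G ε (γ z) ∩ Set.Icc 0 τ), ∑ i : Fin (N + 1), ∑ j : Fin (N + 1), (if i ≠ j ∧ ‖G.sepVec (γ z s i).1 (γ z s j).1‖ = ε then Fn z s i j else 0); Literature.MathematicalPhysics.KineticTheory.localGibbsLaw σ a₀ u₀ θ₀ N (Φ N) {z | Kc (fun z s i j => χ (s, (γ z s i).1) * Ξ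 (ε⁻¹ • G.sepVec (γ z s i).1 (γ z s j).1, (pv z s i j).1, (pv z s i j).2)) z < g₀ * σ ^ 3 * (∫ s in Set.Icc (0 : ℝ) τ, ∫ x : UnitAddTorus (Fin 3), χ (s, x) * B Ξ z s x) - η} ≤ ENNReal.ofReal δ

/-- The entropic-anchor text is also a weakening of the filed crux. [folklore] -/
theorem rateFloorEntropicAnchor_of_rateFloor (h : RateFloor) : RateFloorEntropicAnchor := by
  obtain ⟨g₀, hg₀, H⟩ := h
  refine ⟨g₀, hg₀, fun a₀ θ₀ u₀ ha hθ hu hap hθp => ?_⟩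
  obtain ⟨σ₀, hσ₀, H1⟩ := H a₀ θ₀ u₀ ha hθ hu hap hθp
  exact ⟨σ₀, hσ₀, fun σ hσ hσ' T ρ θ u _ Φ τ hτ _ _ _ _ _ => H1 σ hσ hσ' Φ τ hτ⟩

/-- The closure crux with the entropic-anchor floor as third hypothesis. [folklore] -/
def ParityBandClosureEntropic : Prop :=
  OddContactSymmetry → EvenStressEnskog → RateFloorEntropicAnchor → LocalSecondLaw → DensityCap →
    _root_.HydrodynamicLimit

/-- It implies the filed closure crux. [folklore] -/
theorem parityBandClosure_of_entropic (h : ParityBandClosureEntropic) : ParityBandClosure :=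
  fun h₂ h₃ h₄ h₅ h₆ => h h₂ h₃ (rateFloorEntropicAnchor_of_rateFloor h₄) h₅ h₆

/-- Shape of the deciding theorem under variant R2: still `h₇ h₂ h₃ h₄ h₅ h₆`. [folklore] -/
theorem closes_entropic (h₂ : OddContactSymmetry) (h₃ : EvenStressEnskog) (h₄ : RateFloorEntropicAnchor)
    (h₅ : LocalSecondLaw) (h₆ : DensityCap) (h₇ : ParityBandClosureEntropic) : _root_.HydrodynamicLimit :=
  h₇ h₂ h₃ h₄ h₅ h₆

end Summit.AtomisticToContinuum.HydrodynamicLimit.Theorems.RateFloorRestated
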